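import Literature.Computability.Complexity.PromiseTruthTable
import Literature.Computability.Complexity.PEAToPED
import Literature.Computability.Complexity.CodeFPLists
import Literature.Computability.Complexity.CodeFPStrings
import Literature.Computability.Complexity.LengthCompare
import HarnessLib

/-!
# PneNP / SzkEntropy — crux `PeaThreeNotInP`, line SketchIdeator3, stub `stub_pedCookPea`:
# `PED_d` Cook-reduces to `PEA_d` (DGRV §3, "PED reduces to PEA")

Dvir–Gutfreund–Rothblum–Vadhan [DGRV 2010, §3 p. 6]: to compare `H(p)` with `H(q)` up to an
additive gap, ask a `PEA` oracle for the thresholds `j = 0, 1, 2, …` of both maps and compare the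
numbers of `1`-answers.  In the tree's integer-threshold conventions (`PED d`: YES
`H(q) + 1 ≤ H(p)`, NO `H(p) + 1 ≤ H(q)`; `PEA d`: YES `j + 1 ≤ H(r)`, NO `H(r) ≤ j`) the reduction
first SQUARES both maps (`H(r × r) = 2H(r)`, doubling the gap), then, on `x = code ((n, p), (n', q))`
with `N := 2|x| + 1`, asks the `2N` NONADAPTIVE queries `(2n, p × p, i)`, `(2n', q × q, i)`, `i < N`,
and accepts iff the `q`-side has fewer `1`-answers than the `p`-side (`c_q < c_p`).
* Polynomial time, machine-free, in the typed algebra `CodeFP` over the UNTYPED presentation of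
  instances (variable indices as naturals; `uPED`, `encode_PED_eq_upedE`): the square `sqU`, the
  query generator `qryU` (`codeFP_qryU`), the counting verdict `verdictU` (`codeFP_verdictU`).
* Correctness against EVERY oracle solving `PEA_d` (Goldreich's non-smart Cook reductions): for
  `r` of degree `≤ d`, `h := H(r) ≤ |r| ≤ |x|`, the answer to threshold `i` is `1` if
  `i + 1 ≤ 2h`, `0` if `2h ≤ i`, arbitrary for the at most one `i` in between, so
  `⌊2h⌋ ≤ c ≤ ⌈2h⌉` (`count_sq_answers`); YES: `c_q ≤ ⌈2H(q)⌉ < ⌊2H(p)⌋ ≤ c_p`, NO symmetrically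
  (`ceil_two_mul_lt_floor_two_mul`); then `PromiseProblem.cookReducible_of_truthTable`.

References: Z. Dvir, D. Gutfreund, G. N. Rothblum, S. Vadhan, *On approximating the entropy of
polynomial mappings*, ICS 2011 (ECCC TR10-160), §3 p. 6; O. Goldreich, *On promise problems*
(2006), §1.2 Def. 3; S. Arora, B. Barak, *Computational Complexity*, CUP 2009, §0.1, §1.3.
-/

noncomputable section
open Finset Matrix
open scoped Kronecker
open _root_.Computability Literature.InformationTheory.Entropy Literature.Computability.Complexity

namespace Summit.PneNP.PneNP.Cruxes.PeaThreeNotInP.TensorIsoLine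
set_option linter.dupNamespace false -- `Summit.PneNP.PneNP.…`: summit = sub-problem name (D-0017 single-conjunct layout)

open CodeFP Polynomial

/-! ### Untyped presentations and their codes -/

/-- The code of untyped sparse maps: three nested headed lists of binary numerals (the `CodeFP`
spelling of `PolyMapF2.encoding`, `polyMapF2_encode_eq`). [AroraBarak2009, §0.1] -/
abbrev umapE : List (List (List ℕ)) → List Bool := listE (listE (listE natE))

/-- The code of untyped `PED` instances `((n, P), (n', Q))` (the `CodeFP` spelling of
`PEDInst.encoding`, `encode_PED_eq_upedE`). [AroraBarak2009, §0.1] -/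
abbrev upedE : (ℕ × List (List (List ℕ))) × (ℕ × List (List (List ℕ))) → List Bool :=
  pairE (pairE natE umapE) (pairE natE umapE)

/-- The code of untyped `PEA` instances `(n, P, j)` (the `CodeFP` spelling of `PEAInst.encoding`,
`encode_PEA_eq_upeaE`). [AroraBarak2009, §0.1] -/
abbrev upeaE : ℕ × List (List (List ℕ)) × ℕ → List Bool := pairE natE (pairE umapE natE)

/-- The untyped presentation of a `PED` instance `((n, p), (n', q))`: variable indices `Fin n`,
`Fin n'` replaced by their values. [AroraBarak2009, §0.1] -/
def uPED (I : PEDInst) : (ℕ × List (List (List ℕ))) × (ℕ × List (List (List ℕ))) :=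
  ((I.1.1, I.1.2.map (List.map (List.map Fin.val))), (I.2.1, I.2.2.map (List.map (List.map Fin.val))))

/-- The route's code of a sparse map is the untyped code of its untyped presentation.
[AroraBarak2009, §0.1] -/
theorem polyMapF2_encode_eq (n : ℕ) : ((PolyMapF2.encoding n).encode : PolyMapF2 n → List Bool) =
    fun P => umapE (P.map (List.map (List.map Fin.val))) := by
  have hc : ∀ {α β : Type} (e : β → List Bool) (h : α → β), listE (e ∘ h) = listE e ∘ List.map h := by
    intro α β e h
    funext l
    simp [listE, rawE, List.map_map]
  rw [PolyMapF2.encoding, listE_eq, listE_eq, listE_eq,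
    show ((encodingFinBool n).encode : Fin n → List Bool) = natE ∘ Fin.val from rfl, hc, hc, hc]
  rfl

/-- **The code of a `PED` instance is the untyped code of its untyped presentation.**
[AroraBarak2009, §0.1] -/
theorem encode_PED_eq_upedE (I : PEDInst) : PEDInst.encoding.encode I = upedE (uPED I) := by
  obtain ⟨⟨n, p⟩, ⟨n', q⟩⟩ := I
  change boolPair (boolPair (encodeNat n) ((PolyMapF2.encoding n).encode p))
    (boolPair (encodeNat n') ((PolyMapF2.encoding n').encode q)) = _
  rw [polyMapF2_encode_eq, polyMapF2_encode_eq]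
  rfl

/-- The code of a `PEA` instance is the untyped code of its untyped presentation.
[AroraBarak2009, §0.1] -/
theorem encode_PEA_eq_upeaE (I : PEAInst) :
    PEAInst.encoding.encode I = upeaE (I.1, I.2.1.map (List.map (List.map Fin.val)), I.2.2) := by
  obtain ⟨n, p, k⟩ := I
  change boolPair (encodeNat n) (boolPair ((PolyMapF2.encoding n).encode p) (encodeNat k)) = _
  rw [polyMapF2_encode_eq]
  rfl

/-- Both maps have at most `|code|` output polynomials. [folklore] -/
theorem length_le_length_upedE (u : (ℕ × List (List (List ℕ))) × (ℕ × List (List (List ℕ)))) :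
    u.1.2.length ≤ (upedE u).length ∧ u.2.2.length ≤ (upedE u).length := by
  obtain ⟨⟨n, P⟩, ⟨n', Q⟩⟩ := u
  have hP := length_le_length_rawE (listE (listE natE)) P
  have hQ := length_le_length_rawE (listE (listE natE)) Q
  simp only [pairE_apply, length_boolPair, listE, length_unE]
  omega

/-! ### The programs: square, query generator, verdict -/

/-- The direct square of an untyped map in `n` variables: the map followed by its copy on the
variables shifted by `n` (untyped `PolyMapF2.prod p p`). [DvirGutfreundRothblumVadhan2010, §3 p.6] -/
def sqU (t : ℕ × List (List (List ℕ))) : List (List (List ℕ)) :=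
  t.2 ++ t.2.map (List.map (List.map (t.1 + ·)))

/-- `sqU` is the untyped presentation of the direct square. [DvirGutfreundRothblumVadhan2010, §3 p.6] -/
theorem map_prod_self {n : ℕ} (p : PolyMapF2 n) :
    (p.prod p).map (List.map (List.map Fin.val)) = sqU (n, p.map (List.map (List.map Fin.val))) := by
  simp only [sqU, PolyMapF2.prod, List.map_append, List.map_map, Function.comp_def, Fin.val_castAdd,
    Fin.val_natAdd]

/-- **The direct square is computed on codes in polynomial time** (three nested maps adding `n` to
every index, then a concatenation). [AroraBarak2009, §1.3] -/
theorem codeFP_sqU : CodeFP (pairE natE umapE) umapE sqU := by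
  have h1 : CodeFP (pairE natE (listE natE)) (listE natE) (fun t => t.2.map (t.1 + ·)) :=
    ((listOfRaw natE).comp ((map natAdd).comp
      ((fst _ _).pair ((rawOfList natE).comp (snd _ _))))).congr fun _ => rfl
  have h2 : CodeFP (pairE natE (listE (listE natE))) (listE (listE natE))
      (fun t => t.2.map (List.map (t.1 + ·))) :=
    ((listOfRaw _).comp ((map h1).comp ((fst _ _).pair ((rawOfList _).comp (snd _ _))))).congr
      fun _ => rfl
  have h3 : CodeFP (pairE natE (rawE (listE (listE natE)))) (rawE (listE (listE natE)))
      (fun t => t.2.map (List.map (List.map (t.1 + ·)))) := (map h2).congr fun _ => rfl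
  have hraw : CodeFP (pairE natE umapE) (rawE (listE (listE natE))) (fun t => t.2) :=
    ((rawOfList _).comp (snd _ _)).congr fun _ => rfl
  exact ((listOfRaw _).comp ((rawAppend _).comp (hraw.pair (h3.comp ((fst _ _).pair hraw))))).congr
    fun _ => rfl

/-- **The `i`-th query** on the untyped instance `u = ((n, P), (n', Q))`, `N := 2|code u| + 1`: the
`PEA` instance `(2n, P × P, i)` for `i < N`, `(2n', Q × Q, i - N)` for `N ≤ i`.
[DvirGutfreundRothblumVadhan2010, §3 p.6] -/
def qryU (t : ((ℕ × List (List (List ℕ))) × (ℕ × List (List (List ℕ)))) × ℕ) :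
    ℕ × List (List (List ℕ)) × ℕ :=
  if t.2 < 2 * (upedE t.1).length + 1 then (t.1.1.1 + t.1.1.1, sqU t.1.1, t.2)
  else (t.1.2.1 + t.1.2.1, sqU t.1.2, t.2 - (2 * (upedE t.1).length + 1))

/-- `N = 2|code u| + 1` in unary, on codes. [AroraBarak2009, §1.3] -/
theorem codeFP_N : CodeFP upedE unE (fun u => 2 * (upedE u).length + 1) :=
  (unSucc.comp ((unMulConst 2).comp (strLength.comp
    (transparent (eβ := strE) (g := fun u => upedE u) fun _ => rfl)))).congr fun _ => rfl

/-- **The query generator is computed on codes in polynomial time** (input `⟨code u, 1ⁱ⟩`).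
[AroraBarak2009, §1.3] -/
theorem codeFP_qryU : CodeFP (pairE upedE unE) upeaE qryU := by
  have hi : CodeFP (pairE upedE unE) natE (fun t => t.2) :=
    (natOfUn.comp (snd _ _)).congr fun _ => rfl
  have hN : CodeFP (pairE upedE unE) natE (fun t => 2 * (upedE t.1).length + 1) :=
    (natOfUn.comp (codeFP_N.comp (fst _ _))).congr fun _ => rfl
  have hlt : CodeFP (pairE upedE unE) bitE (fun t => decide (t.2 < 2 * (upedE t.1).length + 1)) := by
    exact (natLt.comp (hi.pair hN) :)
  have hsub : CodeFP (pairE upedE unE) natE (fun t => t.2 - (2 * (upedE t.1).length + 1)) := by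
    exact (natSub.comp (hi.pair hN) :)
  have hp : CodeFP (pairE upedE unE) (pairE natE umapE) (fun t => t.1.1) := (fst _ _).fst'
  have hq : CodeFP (pairE upedE unE) (pairE natE umapE) (fun t => t.1.2) := (fst _ _).snd'
  have hn1 : CodeFP (pairE upedE unE) natE (fun t => t.1.1.1 + t.1.1.1) := by
    exact (natAdd.comp (hp.fst'.pair hp.fst') :)
  have hn2 : CodeFP (pairE upedE unE) natE (fun t => t.1.2.1 + t.1.2.1) := by
    exact (natAdd.comp (hq.fst'.pair hq.fst') :)
  have hb1 : CodeFP (pairE upedE unE) upeaE (fun t => (t.1.1.1 + t.1.1.1, sqU t.1.1, t.2)) := by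
    exact (hn1.pair ((codeFP_sqU.comp hp).pair hi) :)
  have hb2 : CodeFP (pairE upedE unE) upeaE
      (fun t => (t.1.2.1 + t.1.2.1, sqU t.1.2, t.2 - (2 * (upedE t.1).length + 1))) := by
    exact (hn2.pair ((codeFP_sqU.comp hq).pair hsub) :)
  refine (hlt.ite hb1 hb2).congr fun t => ?_
  unfold qryU
  by_cases h : t.2 < 2 * (upedE t.1).length + 1
  · rw [decide_eq_true h, if_pos rfl, if_pos h]
  · rw [decide_eq_false h, if_neg Bool.false_ne_true, if_neg h]

/-- **The verdict** on the untyped instance `u` and the list of the `2N` oracle answers: accept iff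
fewer `1`-answers (`[true]`) among the last `N` (the `q`-side) than among the first `N` (the
`p`-side). [DvirGutfreundRothblumVadhan2010, §3 p.6] -/
def verdictU (t : ((ℕ × List (List (List ℕ))) × (ℕ × List (List (List ℕ)))) × List (List Bool)) :
    Bool :=
  decide ((t.2.drop (2 * (upedE t.1).length + 1)).count [true] <
    (t.2.take (2 * (upedE t.1).length + 1)).count [true])

/-- **The verdict is computed on codes in polynomial time** (input `⟨code u, listBool answers⟩`;
the `1`-answers are counted by a `filter`). [AroraBarak2009, §1.3] -/
theorem codeFP_verdictU : CodeFP (pairE upedE (listE strE)) bitE verdictU := by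
  have hp : CodeFP (pairE unitE strE) bitE (fun q : Unit × List Bool => q.2 == [true]) :=
    ((beq (fun _ _ h => h)).comp ((snd unitE strE).pair (const _ [true]))).congr fun _ => rfl
  have hcnt : CodeFP (rawE strE) natE (fun l : List (List Bool) => l.count [true]) :=
    ((natLength strE).comp ((filter hp).comp ((const (rawE strE) ()).pair (CodeFP.id _)))).congr
      fun l => by
        show (l.filter fun x => x == [true]).length = l.count [true]
        rw [List.count_eq_length_filter]
  have has : CodeFP (pairE upedE (listE strE)) (rawE strE) (fun t => t.2) :=
    ((rawOfList strE).comp (snd _ _)).congr fun _ => rfl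
  have hN : CodeFP (pairE upedE (listE strE)) unE (fun t => 2 * (upedE t.1).length + 1) :=
    codeFP_N.comp (fst _ _)
  have htake : CodeFP (pairE upedE (listE strE)) (rawE strE)
      (fun t => t.2.take (2 * (upedE t.1).length + 1)) := (rawTakeUn strE).comp (hN.pair has)
  have hdrop : CodeFP (pairE upedE (listE strE)) (rawE strE)
      (fun t => t.2.drop (2 * (upedE t.1).length + 1)) := (rawDropUn strE).comp (hN.pair has)
  exact (natLt.comp ((hcnt.comp hdrop).pair (hcnt.comp htake))).congr fun _ => rfl

/-! ### Counting thresholds below a real number -/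

/-- `#{i < N : i < m} = min m N`. [folklore] -/
theorem countP_lt_range (m : ℕ) : ∀ N : ℕ, (List.range N).countP (fun i => decide (i < m)) = min m N
  | 0 => by simp
  | N + 1 => by
    rw [List.range_succ, List.countP_append, countP_lt_range m N]
    by_cases h : N < m
    · simp [h]; omega
    · simp [h]; omega

/-- **Lower count**: if the answers to the thresholds `i` with `i + 1 ≤ t` are `1`, at least `⌊t⌋`
of the answers to the thresholds `i < N` are `1` (`t ≤ N`). [DvirGutfreundRothblumVadhan2010, §3 p.6] -/
theorem floor_le_count_map_range {a : ℕ → List Bool} {t : ℝ} {N : ℕ} (ht : t ≤ N)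
    (hyes : ∀ i : ℕ, (i : ℝ) + 1 ≤ t → a i = [true]) :
    ⌊t⌋₊ ≤ ((List.range N).map a).count [true] := by
  have hfl : ⌊t⌋₊ ≤ N := (Nat.floor_mono ht).trans_eq (Nat.floor_natCast N)
  calc ⌊t⌋₊ = min ⌊t⌋₊ N := (min_eq_left hfl).symm
    _ = (List.range N).countP (fun i => decide (i < ⌊t⌋₊)) := (countP_lt_range _ _).symm
    _ ≤ (List.range N).countP (fun i => a i == [true]) := by
        refine List.countP_mono_left fun i _ hi => ?_
        have hi' : i < ⌊t⌋₊ := by simpa using hi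
        have hle : ((i + 1 : ℕ) : ℝ) ≤ t := (Nat.le_floor_iff' (Nat.succ_ne_zero i)).1 hi'
        simp [hyes i (by exact_mod_cast hle)]
    _ = ((List.range N).map a).count [true] := by rw [List.count_eq_countP, List.countP_map]; rfl

/-- **Upper count**: if the answers to the thresholds `i` with `t ≤ i` are `0`, at most `⌈t⌉` of
the answers to the thresholds `i < N` are `1`. [DvirGutfreundRothblumVadhan2010, §3 p.6] -/
theorem count_map_range_le_ceil {a : ℕ → List Bool} {t : ℝ} (N : ℕ)
    (hno : ∀ i : ℕ, t ≤ i → a i = [false]) : ((List.range N).map a).count [true] ≤ ⌈t⌉₊ := by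
  calc ((List.range N).map a).count [true] = (List.range N).countP (fun i => a i == [true]) := by
        rw [List.count_eq_countP, List.countP_map]; rfl
    _ ≤ (List.range N).countP (fun i => decide (i < ⌈t⌉₊)) := by
        refine List.countP_mono_left fun i _ hi => ?_
        rw [decide_eq_true_eq]
        by_contra hlt
        rw [hno i ((Nat.le_ceil t).trans (by exact_mod_cast Nat.not_lt.1 hlt))] at hi
        simp at hi
    _ = min ⌈t⌉₊ N := countP_lt_range _ _
    _ ≤ ⌈t⌉₊ := min_le_left _ _

/-- **The doubled gap separates the counts**: `a + 1 ≤ b`, `0 ≤ a` give `⌈2a⌉ < ⌊2b⌋`.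
[DvirGutfreundRothblumVadhan2010, §3 p.6] -/
theorem ceil_two_mul_lt_floor_two_mul {a b : ℝ} (ha : 0 ≤ a) (h : a + 1 ≤ b) :
    ⌈2 * a⌉₊ < ⌊2 * b⌋₊ := by
  have h1 : (⌈2 * a⌉₊ : ℝ) < 2 * a + 1 := Nat.ceil_lt_add_one (by linarith)
  have h2 : 2 * b < ⌊2 * b⌋₊ + 1 := Nat.lt_floor_add_one _
  have h3 : (⌈2 * a⌉₊ : ℝ) < ⌊2 * b⌋₊ := by linarith
  exact_mod_cast h3

/-- **An oracle solving `PEA_d` brackets twice the entropy**: on the queries `(2m, r × r, i)`,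
`i < N`, for `r` of degree `≤ d` with `2H(r) ≤ N`, the number `c` of `1`-answers satisfies
`⌊2H(r)⌋ ≤ c ≤ ⌈2H(r)⌉`: thresholds `i + 1 ≤ 2H(r) = H(r × r)` are YES instances, thresholds
`2H(r) ≤ i` NO instances, at most one threshold is off the promise.
[DvirGutfreundRothblumVadhan2010, §3 p.6; Goldreich2006, §1.2 Def. 3] -/
theorem count_sq_answers {d : ℕ} {O : Oracle} (hO : (PEA d).SolvedBy O) {m : ℕ} {r : PolyMapF2 m}
    (hr : r.DegLE d) {N : ℕ} (hN : 2 * r.entropy ≤ N) :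
    ⌊2 * r.entropy⌋₊ ≤ ((List.range N).map fun i =>
        O (PEAInst.encoding.encode ⟨m + m, (r.prod r, i)⟩)).count [true] ∧
      ((List.range N).map fun i =>
        O (PEAInst.encoding.encode ⟨m + m, (r.prod r, i)⟩)).count [true] ≤ ⌈2 * r.entropy⌉₊ := by
  refine ⟨floor_le_count_map_range hN fun i hi =>
      hO.2.1 _ ((encode_mem_PEA_yes_iff d _).2 ⟨hr.prod hr, ?_⟩),
    count_map_range_le_ceil N fun i hi => hO.2.2 _ ((encode_mem_PEA_no_iff d _).2 ⟨hr.prod hr, ?_⟩)⟩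
  · show (i : ℝ) + 1 ≤ (r.prod r).entropy
    rwa [PolyMapF2.entropy_prod_self]
  · show (r.prod r).entropy ≤ i
    rwa [PolyMapF2.entropy_prod_self]

section Instance

variable {Q g₀ : List Bool → List Bool}
  (hQs : ∀ a, Q (pairE upedE unE a) = upeaE (qryU a))
  (hgs : ∀ a, g₀ (pairE upedE (listE strE) a) = bitE (verdictU a))

/-- The length of the code of an instance is the length of its untyped code. [folklore] -/
theorem length_encode_PED (I : PEDInst) :
    (upedE (uPED I)).length = (PEDInst.encoding.encode I).length := by
  rw [encode_PED_eq_upedE]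

/-- The query input `⟨x, 1ᵏ⟩` on an instance is the code of `(untyped instance, k)`. [folklore] -/
theorem boolPair_encode_replicate (I : PEDInst) (k : ℕ) :
    boolPair (PEDInst.encoding.encode I) (List.replicate k true) = pairE upedE unE (uPED I, k) := by
  rw [encode_PED_eq_upedE]
  change _ = boolPair (upedE (uPED I)) (unE k)
  rw [unE_eq_ones]

include hQs in
/-- **The transcript**: the `2N` answers are the answers to the `PEA` instances `(2n, p × p, i)`,
`i < N`, followed by the answers to `(2n', q × q, j)`, `j < N`. [DvirGutfreundRothblumVadhan2010, §3 p.6] -/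
theorem ttAnswers_PED (O : Oracle) (I : PEDInst) :
    ttAnswers Q O (PEDInst.encoding.encode I)
        (2 * (PEDInst.encoding.encode I).length + 1 + (2 * (PEDInst.encoding.encode I).length + 1)) =
      ((List.range (2 * (PEDInst.encoding.encode I).length + 1)).map fun i =>
          O (PEAInst.encoding.encode ⟨I.1.1 + I.1.1, (I.1.2.prod I.1.2, i)⟩)) ++
        ((List.range (2 * (PEDInst.encoding.encode I).length + 1)).map fun j =>
          O (PEAInst.encoding.encode ⟨I.2.1 + I.2.1, (I.2.2.prod I.2.2, j)⟩)) := by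
  obtain ⟨⟨n, p⟩, ⟨n', q⟩⟩ := I
  rw [ttAnswers, List.range_add, List.map_append, List.map_map]
  congr 1
  · -- queries `i < N`: `(2n, p × p, i)`
    refine List.map_congr_left fun i hi => ?_
    replace hi := List.mem_range.1 hi
    rw [← length_encode_PED] at hi
    rw [boolPair_encode_replicate, hQs, qryU, encode_PEA_eq_upeaE]
    dsimp only [uPED]
    rw [if_pos (by exact hi), map_prod_self]
  · -- queries `N + j`: `(2n', q × q, j)`
    refine List.map_congr_left fun j _ => ?_
    rw [Function.comp_apply, boolPair_encode_replicate, hQs, ← length_encode_PED, qryU,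
      encode_PEA_eq_upeaE]
    dsimp only [uPED]
    rw [if_neg (by omega), Nat.add_sub_cancel_left, map_prod_self]

include hgs in
/-- **The verdict on the coded transcript** of an instance: compare the counts of `1`-answers of
two blocks of length `N`. [DvirGutfreundRothblumVadhan2010, §3 p.6] -/
theorem verdict_PED (I : PEDInst) {A B : List (List Bool)}
    (hA : A.length = 2 * (PEDInst.encoding.encode I).length + 1) :
    g₀ (boolPair (PEDInst.encoding.encode I) ((encodingList Bool).listBool.encode (A ++ B))) =
      [decide (B.count [true] < A.count [true])] := by
  have h1 : boolPair (PEDInst.encoding.encode I) ((encodingList Bool).listBool.encode (A ++ B)) =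
      pairE upedE (listE strE) (uPED I, A ++ B) := by
    rw [encode_PED_eq_upedE, pairE_apply, listE_eq]
    rfl
  rw [h1, hgs, verdictU, bitE]
  dsimp only
  rw [length_encode_PED, List.drop_left' hA, List.take_left' hA]

include hQs hgs in
/-- **The verdict brackets**: on an instance `((n, p), (n', q))` with both maps of degree `≤ d`,
against any oracle solving `PEA_d`, the reduction outputs `[c_q < c_p]` with
`⌊2H(p)⌋ ≤ c_p ≤ ⌈2H(p)⌉` and `⌊2H(q)⌋ ≤ c_q ≤ ⌈2H(q)⌉`. [DvirGutfreundRothblumVadhan2010, §3 p.6] -/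
theorem verdict_ttAnswers {d : ℕ} {O : Oracle} (hO : (PEA d).SolvedBy O) (I : PEDInst)
    (hp : I.1.2.DegLE d) (hq : I.2.2.DegLE d) :
    ∃ cp cq : ℕ,
      g₀ (boolPair (PEDInst.encoding.encode I) ((encodingList Bool).listBool.encode
        (ttAnswers Q O (PEDInst.encoding.encode I)
          ((4 * X + 2 : Polynomial ℕ).eval (PEDInst.encoding.encode I).length)))) =
        [decide (cq < cp)] ∧
      ⌊2 * I.1.2.entropy⌋₊ ≤ cp ∧ cp ≤ ⌈2 * I.1.2.entropy⌉₊ ∧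
      ⌊2 * I.2.2.entropy⌋₊ ≤ cq ∧ cq ≤ ⌈2 * I.2.2.entropy⌉₊ := by
  set N := 2 * (PEDInst.encoding.encode I).length + 1 with hN
  have heval : (4 * X + 2 : Polynomial ℕ).eval (PEDInst.encoding.encode I).length = N + N := by
    simp only [eval_add, eval_mul, eval_ofNat, eval_X, hN]; ring
  have hlen : ∀ {m : ℕ} (r : PolyMapF2 m), r.length ≤ (upedE (uPED I)).length → 2 * r.entropy ≤ N := by
    intro m r hr
    rw [length_encode_PED] at hr
    have h1 := PolyMapF2.entropy_le_length r
    have h2 : (r.length : ℝ) ≤ (PEDInst.encoding.encode I).length := by exact_mod_cast hr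
    rw [hN]; push_cast; linarith
  obtain ⟨h1, h2⟩ := length_le_length_upedE (uPED I)
  obtain ⟨hp1, hp2⟩ := count_sq_answers hO hp (hlen I.1.2 (by simpa [uPED] using h1))
  obtain ⟨hq1, hq2⟩ := count_sq_answers hO hq (hlen I.2.2 (by simpa [uPED] using h2))
  refine ⟨_, _, ?_, hp1, hp2, hq1, hq2⟩
  rw [heval, ttAnswers_PED hQs O I, verdict_PED hgs I (by simp)]

end Instance

/-- **stub_pedCookPea** (C2): **`PED_d` Cook-reduces to `PEA_d`** (nonadaptive: query
`PEA(p × p, i)` and `PEA(q × q, i)` for all `i ≤ 2|x|`, accept iff more `1`-answers on the `p`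
side; integer thresholds leave at most one off-promise slot per map, the squares double the gap),
correct against every oracle solving `PEA_d` (Goldreich's Def. 3); the separating evaluator is the
language of strings on which the `FP` function of `codeFP_verdictU` answers `1`.
[DvirGutfreundRothblumVadhan2010, §3 p.6 ("PED reduces to PEA"); Goldreich2006, §1.2 Def. 3] -/
theorem stub_pedCookPea (d : ℕ) : (PED d).CookReducible (PEA d) := by
  classical
  obtain ⟨Q, hQ, hQs⟩ := codeFP_qryU
  obtain ⟨g₀, hg₀, hgs⟩ := codeFP_verdictU
  set g : List Bool → List Bool := HashBricks.headBitFn ∘ g₀ with hg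
  have hone : ∀ w, g w = [(g₀ w).headD false] := fun w => by
    rw [hg, Function.comp_apply, HashBricks.headBitFn_apply]
  set D : Language Bool := {w | g w = [true]} with hDdef
  have hD : D ∈ Classes.P := by
    refine mem_P_of_mem_FP (g := g) (comp_mem_FP HashBricks.headBitFn_mem_FP hg₀) D fun w =>
      ⟨fun hw => hw, fun hw => ?_⟩
    have hw' : g w ≠ [true] := hw
    rw [hone] at hw' ⊢
    cases hb : (g₀ w).headD false
    · rfl
    · exact absurd (by rw [hb]) hw'
  refine PromiseProblem.cookReducible_of_truthTable hQ (4 * X + 2) hD fun O hO x => ⟨?_, ?_⟩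
  · rintro ⟨I, ⟨hp, hq, hH⟩, rfl⟩
    obtain ⟨cp, cq, hval, hp1, -, -, hq2⟩ := verdict_ttAnswers hQs hgs hO I hp hq
    have hlt : cq < cp :=
      hq2.trans_lt ((ceil_two_mul_lt_floor_two_mul (mapEntropy_nonneg _ _) hH).trans_le hp1)
    show g _ = [true]
    rw [hone, hval, decide_eq_true hlt]
    rfl
  · rintro ⟨I, ⟨hp, hq, hH⟩, rfl⟩ hmem
    obtain ⟨cp, cq, hval, -, hp2, hq1, -⟩ := verdict_ttAnswers hQs hgs hO I hp hq
    have hle : cp < cq :=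
      hp2.trans_lt ((ceil_two_mul_lt_floor_two_mul (mapEntropy_nonneg _ _) hH).trans_le hq1)
    have hmem' : g _ = [true] := hmem
    rw [hone, hval, decide_eq_false (Nat.not_lt.2 hle.le)] at hmem'
    exact absurd hmem' (by decide)

end Summit.PneNP.PneNP.Cruxes.PeaThreeNotInP.TensorIsoLine
end
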